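import Literature.Probability.RandomPlanarGeometry.EllipticKAGM
import Literature.Analysis.SpecialFunctions.ThetaJacobiIdentity
import Literature.Probability.RandomPlanarGeometry.EllipticKBasic
import HarnessLib

/-!
# Jacobi's parametrisation of the complete elliptic integral: `K = (π/2)·θ₃(q)²`

Assembles Gauss's theorem `K′(k) = π/(2·M(1,k))` (`EllipticKAGM.lean`), the theta AGM
`M(θ₄(q)², θ₃(q)²) = 1` (`ThetaAGM.lean`) and Jacobi's quartic identity (`ThetaJacobiIdentity.lean`)
into the classical inversion formula (Borwein–Borwein, *Pi and the AGM*, Thm 2.3;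
Whittaker–Watson §22.3): for a real nome `0 ≤ q < 1`,

* `ellipticK_thetaFour_modulus` : `K(k) = (π/2)·θ₃(q)²` at the modulus with
  `k′ = θ₄(q)²/θ₃(q)²`, i.e. `ellipticK (1 − (θ₄²/θ₃²)²) = (π/2)θ₃(q)²` (Jacobi-free: AGM only);
* `ellipticK_thetaTwo_modulus`  : the same at the nome `q⁴` in Jacobi's form `k = θ₂²/θ₃²`,
  `θ₂(q⁴) = Θ(q)` the odd part of `θ₃(q)`: `ellipticK ((Θ(q)²/θ₃(q⁴)²)²) = (π/2)θ₃(q⁴)²`, the two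
  moduli being complementary (`thetaModulus_sq_add_complModulus_sq`: `k² + k′² = 1`).

* `thetaModulus s = Θ(e^{−πs/4})²/θ₃(e^{−πs})²` — the modulus `k(q)` of the nome `q = e^{−πs}` —
  has `K(k) = (π/2)θ₃(e^{−πs})²` (`ellipticK_thetaModulus_sq`) and, by the theta transformation
  formulas of `ThetaJacobiIdentity.lean`, `K′(k) = s·K(k)` (`ellipticK_ratio_thetaModulus`):
  **the nome–modulus inversion `K′/K = −(log q)/π`**;
* `ellipticK_sq_singularModulus_eq_theta` — hence (uniqueness of singular moduli,
  `EllipticKBasic.lean`) the `N`-th singular modulus IS `thetaModulus √N` and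
  **`K(k_N) = (π/2)·θ₃(e^{−π√N})²`**. For `N = 15` this reduces the named fact
  `Literature.Analysis.FunctionSpaces.BorweinStraubWanZudilin2012_eq_5_3` (Borwein–Zucker's value of
  `K₁₅²`) to the theta value `θ₃(e^{−π√15})⁴ = (1+√5)·Γ(1/15)Γ(2/15)Γ(4/15)Γ(8/15)/(60π³)` — the
  Chowla–Selberg formula for discriminant `−15`, which is NOT proved anywhere in the tree.

(`ellipticK` is the tree's parameter-convention integral, `K(k) = ellipticK (k²)`.)

## References

* [BorweinBorwein1987] J. M. Borwein, P. B. Borwein, *Pi and the AGM*, Wiley (1987), Ch. 2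
  (§2.1 Thm 2.1; §2.3: `K` and `K′` as theta functions of the nome, singular moduli).
* E. T. Whittaker, G. N. Watson, *A Course of Modern Analysis*, 4th ed., §21.61, §22.3.
-/

noncomputable section

open scoped NNReal
open Literature.Probability.RandomPlanarGeometry

namespace Literature.Analysis.SpecialFunctions

/-- **`K(k) = (π/2)·θ₃(q)²` at `k′ = θ₄(q)²/θ₃(q)²`** (`0 ≤ q < 1`): from `M(θ₄², θ₃²) = 1`,
homogeneity `M(1, θ₄²/θ₃²) = 1/θ₃²` and Gauss's `K′(k′) = K(k) = π/(2·M(1,k′))`.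
[cite: BorweinBorwein1987, Ch. 2 §2.3] -/
theorem ellipticK_thetaFour_modulus {q : ℝ} (hq0 : 0 ≤ q) (hq1 : q < 1) :
    ellipticK (1 - (thetaFour q ^ 2 / thetaThree q ^ 2) ^ 2) = Real.pi / 2 * thetaThree q ^ 2 := by
  have h3 := thetaThree_pos hq0 hq1
  have h4 := thetaFour_pos hq0 hq1
  have hagm := agm_thetaFourSq_thetaThreeSq hq0 hq1
  have hT3 : thetaThreeSq q ≠ 0 := by
    intro h
    have := congrArg (fun x : ℝ≥0 => (x : ℝ)) h
    simp only [coe_thetaThreeSq, NNReal.coe_zero] at this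
    exact (pow_pos h3 2).ne' this
  -- the complementary modulus `k′ = θ₄²/θ₃²` in `ℝ≥0`
  set k' : ℝ≥0 := (thetaThreeSq q)⁻¹ * thetaFourSq q with hk'
  have hk'coe : ((k' : ℝ≥0) : ℝ) = thetaFour q ^ 2 / thetaThree q ^ 2 := by
    rw [hk', NNReal.coe_mul, NNReal.coe_inv, coe_thetaThreeSq, coe_thetaFourSq]
    field_simp
  have hk'pos : 0 < k' := by
    rw [← NNReal.coe_pos, hk'coe]; positivity
  -- `M(1, k′) = 1/θ₃²`
  have hscale : NNReal.agm 1 k' = (thetaThreeSq q)⁻¹ := by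
    have h := NNReal.agm_mul_distrib (k := (thetaThreeSq q)⁻¹) (x := thetaThreeSq q)
      (y := thetaFourSq q)
    rw [inv_mul_cancel₀ hT3, NNReal.agm_comm (x := thetaThreeSq q), hagm, mul_one] at h
    rw [hk']
    exact h
  have hG := ellipticK_compl_eq_pi_div_agm hk'pos
  rw [hscale, hk'coe, NNReal.coe_inv, coe_thetaThreeSq] at hG
  rw [hG]
  field_simp

/-- **`k² + k′² = 1` for the theta moduli** at the nome `q⁴`: `k = Θ(q)²/θ₃(q⁴)²` (`= θ₂²/θ₃²`),
`k′ = θ₄(q⁴)²/θ₃(q⁴)²` — Jacobi's quartic identity divided by `θ₃(q⁴)⁴` (`0 ≤ q < 1`). [folklore] -/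
theorem thetaModulus_sq_add_complModulus_sq {q : ℝ} (hq0 : 0 ≤ q) (hq1 : q < 1) :
    (thetaOdd q ^ 2 / thetaThree (q ^ 4) ^ 2) ^ 2 + (thetaFour (q ^ 4) ^ 2 / thetaThree (q ^ 4) ^ 2) ^ 2
      = 1 := by
  have hq : |q| < 1 := by rwa [abs_of_nonneg hq0]
  have h3 : 0 < thetaThree (q ^ 4) := thetaThree_pos (pow_nonneg hq0 4) (pow_lt_one₀ hq0 hq1 (by norm_num))
  have hJ := jacobi_quartic hq
  have hne : thetaThree (q ^ 4) ^ 4 ≠ 0 := (pow_pos h3 4).ne'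
  field_simp
  linear_combination -hJ

/-- **Jacobi's `K(k) = (π/2)·θ₃²` with `k = θ₂²/θ₃²`**, at the nome `q⁴` where `θ₂(q⁴) = Θ(q)`:
`ellipticK ((Θ(q)²/θ₃(q⁴)²)²) = (π/2)·θ₃(q⁴)²` (`0 ≤ q < 1`). [cite: BorweinBorwein1987, Ch. 2 §2.3] -/
theorem ellipticK_thetaTwo_modulus {q : ℝ} (hq0 : 0 ≤ q) (hq1 : q < 1) :
    ellipticK ((thetaOdd q ^ 2 / thetaThree (q ^ 4) ^ 2) ^ 2) = Real.pi / 2 * thetaThree (q ^ 4) ^ 2 := by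
  have hq40 : 0 ≤ q ^ 4 := pow_nonneg hq0 4
  have hq41 : q ^ 4 < 1 := pow_lt_one₀ hq0 hq1 (by norm_num)
  have h := ellipticK_thetaFour_modulus hq40 hq41
  have e : 1 - (thetaFour (q ^ 4) ^ 2 / thetaThree (q ^ 4) ^ 2) ^ 2 =
      (thetaOdd q ^ 2 / thetaThree (q ^ 4) ^ 2) ^ 2 := by
    have := thetaModulus_sq_add_complModulus_sq hq0 hq1
    linarith
  rw [e] at h
  exact h

/-! ### The nome parametrisation of the singular moduli: `K′/K = s` at `q = e^{−πs}` -/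

/-- `0 < Θ(q)` for `0 < q < 1` (all terms `q^{(2n+1)²}` are positive). [folklore] -/
theorem thetaOdd_pos {q : ℝ} (hq0 : 0 < q) (hq1 : q < 1) : 0 < thetaOdd q := by
  have hq : |q| < 1 := by rwa [abs_of_pos hq0]
  exact (summable_thetaOddTerm hq).tsum_pos (fun n => (pow_pos hq0 _).le) 0 (pow_pos hq0 _)

/-- **The theta modulus of a nome.** For `s > 0` put `Q = e^{−πs}`, `q = e^{−πs/4}` (`q⁴ = Q`);
`thetaModulus s = Θ(q)²/θ₃(Q)² = θ₂(Q)²/θ₃(Q)²` is Jacobi's modulus `k(q)` of the nome `Q`.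
[cite: BorweinBorwein1987, Ch. 2 §2.1–2.3] -/
def thetaModulus (s : ℝ) : ℝ :=
  thetaOdd (Real.exp (-(Real.pi * s / 4))) ^ 2 / thetaThree (Real.exp (-(Real.pi * s))) ^ 2

/-- Nome bookkeeping: `(e^{−πs/4})⁴ = e^{−πs}`. [folklore] -/
theorem exp_neg_pi_mul_div_four_pow (s : ℝ) :
    Real.exp (-(Real.pi * s / 4)) ^ 4 = Real.exp (-(Real.pi * s)) := by
  rw [← Real.exp_nat_mul]; congr 1; ring

/-- `0 < e^{−πs/4} < 1` and `0 < e^{−πs} < 1` for `s > 0`. [folklore] -/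
theorem exp_neg_pi_mul_lt_one {s : ℝ} (hs : 0 < s) (c : ℝ) (hc : 0 < c) :
    Real.exp (-(Real.pi * s / c)) < 1 := by
  rw [Real.exp_lt_one_iff]
  have : 0 < Real.pi * s / c := by positivity
  linarith

/-- **`K(k) = (π/2)·θ₃(e^{−πs})²`** at the theta modulus `k = thetaModulus s` (`s > 0`).
[cite: BorweinBorwein1987, Ch. 2 §2.3] -/
theorem ellipticK_thetaModulus_sq {s : ℝ} (hs : 0 < s) :
    ellipticK (thetaModulus s ^ 2) = Real.pi / 2 * thetaThree (Real.exp (-(Real.pi * s))) ^ 2 := by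
  unfold thetaModulus
  have hq0 : 0 ≤ Real.exp (-(Real.pi * s / 4)) := (Real.exp_pos _).le
  have hq1 : Real.exp (-(Real.pi * s / 4)) < 1 := exp_neg_pi_mul_lt_one hs 4 (by norm_num)
  have h := ellipticK_thetaTwo_modulus hq0 hq1
  rwa [exp_neg_pi_mul_div_four_pow] at h

/-- **The complementary integral at the theta modulus is `s` times `K`**:
`K′(k) = ellipticK (1 − k²) = s·(π/2)·θ₃(e^{−πs})²` for `k = thetaModulus s`, `s > 0`. Proof: by
Jacobi, `1 − k² = (θ₄(Q)²/θ₃(Q)²)²`; by the transformation formulas this is the SQUARED theta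
modulus of the dual nome `Q′ = e^{−π/s}`, where `K = (π/2)θ₃(Q′)² = (π/2)·s·θ₃(Q)²`.
[cite: BorweinBorwein1987, Ch. 2 §2.3] -/
theorem ellipticK_one_sub_thetaModulus_sq {s : ℝ} (hs : 0 < s) :
    ellipticK (1 - thetaModulus s ^ 2) = s * (Real.pi / 2 * thetaThree (Real.exp (-(Real.pi * s))) ^ 2) := by
  set Q := Real.exp (-(Real.pi * s)) with hQ
  set q := Real.exp (-(Real.pi * s / 4)) with hq
  have hq0 : 0 ≤ q := (Real.exp_pos _).le
  have hq1 : q < 1 := exp_neg_pi_mul_lt_one hs 4 (by norm_num)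
  have hq4 : q ^ 4 = Q := exp_neg_pi_mul_div_four_pow s
  -- `1 − k² = (θ₄(Q)²/θ₃(Q)²)²`
  have hcompl : 1 - thetaModulus s ^ 2 = (thetaFour Q ^ 2 / thetaThree Q ^ 2) ^ 2 := by
    have h := thetaModulus_sq_add_complModulus_sq hq0 hq1
    rw [hq4] at h
    unfold thetaModulus
    rw [← hQ, ← hq]
    linarith
  -- the dual nome `Q′ = e^{−π/s}`, `q′ = e^{−π/(4s)}`
  have hs' : 0 < s⁻¹ := inv_pos.2 hs
  set Q' := Real.exp (-(Real.pi * s⁻¹)) with hQ'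
  set q' := Real.exp (-(Real.pi * s⁻¹ / 4)) with hq'
  have hq'0 : 0 ≤ q' := (Real.exp_pos _).le
  have hq'1 : q' < 1 := exp_neg_pi_mul_lt_one hs' 4 (by norm_num)
  have hq'4 : q' ^ 4 = Q' := exp_neg_pi_mul_div_four_pow s⁻¹
  -- transformation formulas: `θ₃(Q′) = √s θ₃(Q)`, `Θ(q′) = √s θ₄(Q)`
  have hT3 : thetaThree Q' = Real.sqrt s * thetaThree Q := by
    rw [hQ', hQ, show Real.pi * s⁻¹ = Real.pi / s by rw [div_eq_mul_inv]]
    exact thetaThree_exp_neg_pi_div hs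
  have hT2 : thetaOdd q' = Real.sqrt s * thetaFour Q := by
    rw [hq', hQ, show Real.pi * s⁻¹ / 4 = Real.pi / (4 * s) by field_simp]
    exact thetaOdd_exp_neg_pi_div hs
  have hs2 : Real.sqrt s ^ 2 = s := Real.sq_sqrt hs.le
  have hsq : Real.sqrt s ≠ 0 := (Real.sqrt_pos.2 hs).ne'
  have h3pos : 0 < thetaThree Q := thetaThree_pos (Real.exp_pos _).le (by
    rw [hQ]; simpa using exp_neg_pi_mul_lt_one hs 1 one_pos)
  -- the dual modulus squared is `1 − k²`
  have hdual : (thetaOdd q' ^ 2 / thetaThree (q' ^ 4) ^ 2) ^ 2 = (thetaFour Q ^ 2 / thetaThree Q ^ 2) ^ 2 := by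
    rw [hq'4, hT2, hT3]
    congr 1
    field_simp
  have hK := ellipticK_thetaTwo_modulus hq'0 hq'1
  rw [hdual, hq'4, hT3] at hK
  rw [hcompl, hK, mul_pow, hs2]
  ring

/-- `0 < thetaModulus s` (`s > 0`). [folklore] -/
theorem thetaModulus_pos {s : ℝ} (hs : 0 < s) : 0 < thetaModulus s := by
  unfold thetaModulus
  have h1 : 0 < thetaOdd (Real.exp (-(Real.pi * s / 4))) :=
    thetaOdd_pos (Real.exp_pos _) (exp_neg_pi_mul_lt_one hs 4 (by norm_num))
  have h2 : 0 < thetaThree (Real.exp (-(Real.pi * s))) :=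
    thetaThree_pos (Real.exp_pos _).le (by simpa using exp_neg_pi_mul_lt_one hs 1 one_pos)
  positivity

/-- `thetaModulus s < 1` (`s > 0`): `k² + k′² = 1` with `k′ = θ₄²/θ₃² > 0`. [folklore] -/
theorem thetaModulus_lt_one {s : ℝ} (hs : 0 < s) : thetaModulus s < 1 := by
  have hq0 : 0 ≤ Real.exp (-(Real.pi * s / 4)) := (Real.exp_pos _).le
  have hq1 : Real.exp (-(Real.pi * s / 4)) < 1 := exp_neg_pi_mul_lt_one hs 4 (by norm_num)
  have h := thetaModulus_sq_add_complModulus_sq hq0 hq1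
  rw [exp_neg_pi_mul_div_four_pow] at h
  have hQ0 : 0 ≤ Real.exp (-(Real.pi * s)) := (Real.exp_pos _).le
  have hQ1 : Real.exp (-(Real.pi * s)) < 1 := by simpa using exp_neg_pi_mul_lt_one hs 1 one_pos
  have h4 : 0 < thetaFour (Real.exp (-(Real.pi * s))) := thetaFour_pos hQ0 hQ1
  have h3 : 0 < thetaThree (Real.exp (-(Real.pi * s))) := thetaThree_pos hQ0 hQ1
  have hk' : 0 < (thetaFour (Real.exp (-(Real.pi * s))) ^ 2 / thetaThree (Real.exp (-(Real.pi * s))) ^ 2) ^ 2 := by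
    positivity
  have hk : thetaModulus s ^ 2 < 1 := by
    unfold thetaModulus
    linarith
  have hk0 := thetaModulus_pos hs
  nlinarith

/-- **The theta modulus of `e^{−πs}` has `K′/K = s`** (`s > 0`):
`ellipticK (1 − k²) = s · ellipticK (k²)` for `k = thetaModulus s`, with `0 < k < 1`.
[cite: BorweinBorwein1987, Ch. 2 §2.3] -/
theorem ellipticK_ratio_thetaModulus {s : ℝ} (hs : 0 < s) :
    ellipticK (1 - thetaModulus s ^ 2) = s * ellipticK (thetaModulus s ^ 2) := by
  rw [ellipticK_one_sub_thetaModulus_sq hs, ellipticK_thetaModulus_sq hs]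

/-- **The `N`-th singular modulus is the theta modulus of the nome `e^{−π√N}`, and
`K(k_N) = (π/2)·θ₃(e^{−π√N})²`** (`N > 0`): for every `0 < k < 1` with `K′(k) = √N·K(k)`
(there is exactly one, `existsUnique_singularModulus`), `k = thetaModulus √N` and
`ellipticK (k²) = (π/2)·θ₃(e^{−π√N})²`. This is the theta-function half of the evaluation of the
singular values `K(k_N)`; the other half (the value of `θ₃(e^{−π√N})` in Gamma-function terms) is
the Chowla–Selberg formula. [cite: BorweinBorwein1987, Ch. 2 §2.3] -/
theorem ellipticK_sq_singularModulus_eq_theta {N : ℝ} (hN : 0 < N) {k : ℝ} (hk0 : 0 < k) (hk1 : k < 1)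
    (hk : ellipticK (1 - k ^ 2) = Real.sqrt N * ellipticK (k ^ 2)) :
    k = thetaModulus (Real.sqrt N) ∧
      ellipticK (k ^ 2) = Real.pi / 2 * thetaThree (Real.exp (-(Real.pi * Real.sqrt N))) ^ 2 := by
  have hs : 0 < Real.sqrt N := Real.sqrt_pos.2 hN
  obtain ⟨k₀, -, huniq⟩ := existsUnique_singularModulus hN
  have e1 : k = k₀ := huniq k ⟨hk0, hk1, hk⟩
  have e2 : thetaModulus (Real.sqrt N) = k₀ :=
    huniq _ ⟨thetaModulus_pos hs, thetaModulus_lt_one hs, ellipticK_ratio_thetaModulus hs⟩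
  have e : k = thetaModulus (Real.sqrt N) := e1.trans e2.symm
  refine ⟨e, ?_⟩
  rw [e, ellipticK_thetaModulus_sq hs]


end Literature.Analysis.SpecialFunctions

end
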